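import Mathlib
import Literature.Analysis.Convex.LinearProgrammingDuality
import Literature.Computability.Complexity.ApproximateDegreeDuality
import HarnessLib

/-!
# Approximate resilience is dual to `ℓ¹` approximation by low-degree polynomials
# (Dachman-Soled–Feldman–Tan–Wan–Wimmer 2015, Theorem 1.2), by LP duality

Source (read first-hand 2026-08-28, held text `paper:arxiv-1405.5268`, chunks p0004, p0007,
p0009–p0010 of the arXiv version): D. Dachman-Soled, V. Feldman, L.-Y. Tan, A. Wan, K. Wimmer,
*Approximate resilience, monotonicity, and the complexity of agnostic learning*, SODA 2015,
arXiv:1405.5268 [DachmanSoledEtAl2015].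

Printed statements (verbatim up to notation; cube `{−1,1}ⁿ`, `E` uniform, `‖h‖₁ = E|h|`):

* Definition 1.8 (§1.4, Preliminaries): "A function `g : {−1,1}ⁿ → ℝ` is `d`-resilient
  if `ĝ(S) = 0` for all `|S| ≤ d`. We say that a Boolean function `f : {−1,1}ⁿ → {−1,1}` is
  `α`-approximately `d`-resilient if there exists a `d`-resilient bounded function `g` such that
  `‖f − g‖₁ ≤ α`" (§1.1: "a `d`-resilient `g : {−1,1}ⁿ → [−1,1]` such that
  `‖f − g‖₁ = E[|f(x) − g(x)|] ≤ α`").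
* §1.1: "let `𝒫_d` be the class of degree at most `d` real-valued polynomials. For a Boolean function
  `f`, let `Δ_{𝒫_d}(f) = min_{p ∈ 𝒫_d} E[|f − p|]`."
* **Theorem 1.2** (§1.1): "For `f : {−1,1}ⁿ → {−1,1}` and `0 ≤ d ≤ n` and `α ≥ 0`, `f` is
  `α`-approximately `d`-resilient if and only if `Δ_{𝒫_d}(f) ≥ 1 − α`."  Restated (§2, before its proof):
  "let `α` denote the `ℓ₁` distance of `f` to the closest `d`-resilient bounded function. Then
  `Δ_{𝒫_d}(f) = 1 − α`."
* Proof (§2): "`‖f − g‖₁ = 1 − E[fg]` and therefore minimization of distance to resilience can be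
  expressed as maximization of `Σ_x f(x)g(x)` subject to resilience constraints on `g`. Viewing
  values of `g(x)` as variables we get: `max Σ_x f(x)g(x)` subject to `Σ_x g(x)χ_S(x) = 0 ∀|S| ≤ d`
  and `|g(x)| ≤ 1 ∀x`.  The dual LP can be easily verified to be the following program with
  variables `p_S` for every `S ⊆ [n]` of size at most `d`: `min Σ_x |q(x)|` subject to
  `q(x) = f(x) − Σ_{|S|≤d} p_S χ_S(x) ∀x`.  Now the claim of the theorem follows from LP duality."

Rendering.  The cube is `Fin n → Bool` with the tree's Walsh characters; "`d`-resilient" is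
EXACTLY the tree's `Literature.Computability.Complexity.ApproximateDegree.HasPureHighDegree d g`
(`Σ_x g(x)χ_S(x) = 0` for `|S| ≤ d`, `⟺ ĝ(S) = 0`, `hasPureHighDegree_iff_cubeFourierCoeff`;
`ApproximateDegreeDuality.lean`), so no new definition is introduced for it; "`deg p ≤ d`" is
`HasDegreeLE d p`, `E` is `cubeExpect`; `‖f − g‖₁` is `l1Dist f g`, `Δ_{𝒫_d}(f)` is
`l1ApproxError d f` (an infimum over the degree-`≤ d` functions, attained: `exists_optimal_pair`), and
"`α`-approximately `d`-resilient" is `IsApproxResilient α d f`.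

What is proved (no named facts):
* the LP duality of §2 for EVERY real `f` — weak half `cubeExpect_mul_le_l1Dist`
  (`E[fg] ≤ E|f − p|` for resilient bounded `g` and `deg p ≤ d`, since `E[pg] = 0`), strong half
  `exists_optimal_pair` (`∃ g, p` with `E[fg] = E|f − p| = Δ_{𝒫_d}(f)`), obtained from the tree's
  Duality theorem of linear programming `Literature.Analysis.Convex.LPDuality.duality`
  (Schrijver 1986, Cor. 7.1g: `max{cx | Ax ≤ b} = min{yb | y ≥ 0, yA = c}`) applied to the printed
  primal (rows `±g(x) ≤ 1`, `±Σ_x g(x)χ_S(x) ≤ 0`), the dual vector being read as `q = f − p` split into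
  positive and negative parts;
* **Theorem 1.2** for `±1`-valued `f` (`DachmanSoledEtAl2015_thm12`: `IsApproxResilient α d f ↔
  1 − α ≤ l1ApproxError d f`) and its restated form (`DachmanSoledEtAl2015_thm12_restated`: a closest
  resilient bounded `g` exists and its distance is `1 − Δ_{𝒫_d}(f)`), through the identity
  `|f − g| = 1 − fg` for `|f| = 1 ≥ |g|` (`abs_sub_eq_one_sub_mul`).

Typed for the pnp-psdrank cell (memo LIT-39 (N4): the `ℓ¹`/resilience duality is the dual template
of the cell's (BSM) question with the degrees swapped); companion of `ApproximateDegreeDuality.lean`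
(the sup-norm duality, Bun–Thaler 2013) and `SandwichingDuality.lean` (one-sided `ℓ¹`, Bazzi 2009).
No new notation, no instances.
-/

noncomputable section

open Finset Matrix
open Literature.Probability.RandomGraphs.LowDegree (sgn sgn_true sgn_false walsh)
open Literature.Computability.Complexity.LowDegree (cubeFourierCoeff)
open Literature.Combinatorics.Optimization (HasDegreeLE cubeExpect
  hasDegreeLE_iff_cubeFourierCoeff_eq_zero cubeFourierCoeff_sum_walsh)
open Literature.Computability.Complexity.ApproximateDegree (HasPureHighDegree)

namespace Literature.Computability.Complexity.ApproximateResilience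

variable {n : ℕ}

/-! ### Definitions -/

/-- **`‖f − g‖₁ = E[|f(x) − g(x)|]`**, the `ℓ¹` distance on the cube (uniform measure).
[cite: DachmanSoledEtAl2015, §1.1 and Def. 1.8 (§1.4)] -/
def l1Dist (f g : (Fin n → Bool) → ℝ) : ℝ :=
  cubeExpect fun x => |f x - g x|

/-- **`f` is `α`-approximately `d`-resilient**: some `d`-resilient (`ĝ(S) = 0` for all `|S| ≤ d`,
the tree's `HasPureHighDegree d g`) bounded (`|g| ≤ 1`) function `g` has `‖f − g‖₁ ≤ α`.
[cite: DachmanSoledEtAl2015, Def. 1.8 (§1.4) and §1.1] -/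
def IsApproxResilient (α : ℝ) (d : ℕ) (f : (Fin n → Bool) → ℝ) : Prop :=
  ∃ g : (Fin n → Bool) → ℝ, HasPureHighDegree d g ∧ (∀ x, |g x| ≤ 1) ∧ l1Dist f g ≤ α

/-- **`Δ_{𝒫_d}(f) = min_{deg p ≤ d} E[|f − p|]`**, the `ℓ¹` error of the best degree-`≤ d`
approximation (an infimum over a nonempty set bounded below by `0`; attained, `exists_optimal_pair`).
[cite: DachmanSoledEtAl2015, §1.1] -/
def l1ApproxError (d : ℕ) (f : (Fin n → Bool) → ℝ) : ℝ :=
  sInf ((fun p => l1Dist f p) '' {p | HasDegreeLE d p})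

/-! ### Elementary properties -/

/-- `‖f − g‖₁ ≥ 0`. [cite: DachmanSoledEtAl2015, §1.1] -/
theorem l1Dist_nonneg (f g : (Fin n → Bool) → ℝ) : 0 ≤ l1Dist f g :=
  div_nonneg (sum_nonneg fun _ _ => abs_nonneg _) (by positivity)

/-- `Δ_{𝒫_d}(f) ≤ ‖f − p‖₁` for every `p` of degree `≤ d`. [cite: DachmanSoledEtAl2015, §1.1] -/
theorem l1ApproxError_le {d : ℕ} (f : (Fin n → Bool) → ℝ) {p : (Fin n → Bool) → ℝ}
    (hp : HasDegreeLE d p) : l1ApproxError d f ≤ l1Dist f p :=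
  csInf_le ⟨0, by rintro _ ⟨q, _, rfl⟩; exact l1Dist_nonneg f q⟩ ⟨p, hp, rfl⟩

/-- `c ≤ Δ_{𝒫_d}(f)` as soon as `c ≤ ‖f − p‖₁` for every `p` of degree `≤ d` (the infimum is over a
nonempty set: constants have degree `≤ d`). [cite: DachmanSoledEtAl2015, §1.1] -/
theorem le_l1ApproxError {d : ℕ} {f : (Fin n → Bool) → ℝ} {c : ℝ}
    (h : ∀ p : (Fin n → Bool) → ℝ, HasDegreeLE d p → c ≤ l1Dist f p) : c ≤ l1ApproxError d f :=
  le_csInf ⟨_, ⟨fun _ => 0, Literature.Combinatorics.Optimization.HasDegreeLE.const d 0, rfl⟩⟩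
    (by rintro _ ⟨p, hp, rfl⟩; exact h p hp)

/-- `0 ≤ Δ_{𝒫_d}(f)`. [cite: DachmanSoledEtAl2015, §1.1] -/
theorem l1ApproxError_nonneg (d : ℕ) (f : (Fin n → Bool) → ℝ) : 0 ≤ l1ApproxError d f :=
  le_l1ApproxError fun p _ => l1Dist_nonneg f p

/-! ### Weak duality -/

/-- **Weak duality** (§2): for a `d`-resilient `g` with `|g| ≤ 1` and any `p` of degree `≤ d`,
`E[fg] = E[(f − p)g] ≤ E|f − p|` (`E[pg] = 0` by resilience). [cite: DachmanSoledEtAl2015, Thm 1.2 proof in §2] -/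
theorem cubeExpect_mul_le_l1Dist {d : ℕ} {f g p : (Fin n → Bool) → ℝ} (hg : HasPureHighDegree d g)
    (hgb : ∀ x, |g x| ≤ 1) (hp : HasDegreeLE d p) :
    cubeExpect (fun x => f x * g x) ≤ l1Dist f p := by
  unfold l1Dist cubeExpect
  refine div_le_div_of_nonneg_right ?_ (by positivity)
  have h0 : ∑ x, p x * g x = 0 := hg.sum_mul_eq_zero hp
  calc ∑ x, f x * g x = ∑ x, (f x - p x) * g x + ∑ x, p x * g x := by
        rw [← sum_add_distrib]; exact sum_congr rfl fun x _ => by ring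
    _ = ∑ x, (f x - p x) * g x := by rw [h0, add_zero]
    _ ≤ ∑ x, |f x - p x| := sum_le_sum fun x _ => by
        calc (f x - p x) * g x ≤ |(f x - p x) * g x| := le_abs_self _
          _ = |f x - p x| * |g x| := abs_mul _ _
          _ ≤ |f x - p x| * 1 := mul_le_mul_of_nonneg_left (hgb x) (abs_nonneg _)
          _ = |f x - p x| := mul_one _

/-- Hence `E[fg] ≤ Δ_{𝒫_d}(f)` for every `d`-resilient bounded `g`. [cite: DachmanSoledEtAl2015, Thm 1.2 proof in §2] -/
theorem cubeExpect_mul_le_l1ApproxError {d : ℕ} {f g : (Fin n → Bool) → ℝ}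
    (hg : HasPureHighDegree d g) (hgb : ∀ x, |g x| ≤ 1) :
    cubeExpect (fun x => f x * g x) ≤ l1ApproxError d f :=
  le_l1ApproxError fun _ hp => cubeExpect_mul_le_l1Dist hg hgb hp

/-! ### The linear program of §2 and strong duality -/

/-- The constraint matrix of the primal LP of §2 (`max Σ f(x)g(x)` s.t. `|g(x)| ≤ 1`,
`Σ_x g(x)χ_S(x) = 0` for `|S| ≤ d`) in the form `Ag ≤ b`: rows `(x', ±)` are `±e_{x'}` (bound `1`),
rows `(S, ±)` with `|S| ≤ d` are `±χ_S` (bound `0`), rows `(S, ±)` with `|S| > d` are zero.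
[cite: DachmanSoledEtAl2015, Thm 1.2 proof in §2, primal LP] -/
def lpMatrix (n d : ℕ) : Matrix (((Fin n → Bool) ⊕ Finset (Fin n)) × Bool) (Fin n → Bool) ℝ
  | (Sum.inl x', b), x => sgn b * (if x = x' then 1 else 0)
  | (Sum.inr S, b), x => if S.card ≤ d then sgn b * walsh S x else 0

/-- The right-hand side: `1` on the box rows, `0` on the resilience rows.
[cite: DachmanSoledEtAl2015, Thm 1.2 proof in §2, primal LP] -/
def lpRhs (n : ℕ) : ((Fin n → Bool) ⊕ Finset (Fin n)) × Bool → ℝ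
  | (Sum.inl _, _) => 1
  | (Sum.inr _, _) => 0

/-- The box rows of `Ag`. [cite: DachmanSoledEtAl2015, Thm 1.2 proof in §2] -/
theorem lpMatrix_mulVec_inl (d : ℕ) (g : (Fin n → Bool) → ℝ) (x' : Fin n → Bool) (b : Bool) :
    (lpMatrix n d *ᵥ g) (Sum.inl x', b) = sgn b * g x' := by
  simp only [mulVec, dotProduct, lpMatrix]
  simp_rw [mul_ite, mul_one, mul_zero, ite_mul, zero_mul]
  rw [sum_ite_eq' univ x', if_pos (mem_univ _)]

/-- The resilience rows of `Ag`. [cite: DachmanSoledEtAl2015, Thm 1.2 proof in §2] -/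
theorem lpMatrix_mulVec_inr (d : ℕ) (g : (Fin n → Bool) → ℝ) (S : Finset (Fin n)) (b : Bool) :
    (lpMatrix n d *ᵥ g) (Sum.inr S, b) =
      if S.card ≤ d then sgn b * ∑ x, g x * walsh S x else 0 := by
  simp only [mulVec, dotProduct, lpMatrix]
  split_ifs with h
  · rw [mul_sum]
    exact sum_congr rfl fun x _ => by ring
  · simp

/-- **Primal feasible points are exactly the `d`-resilient functions bounded by `1`**, first half.
[cite: DachmanSoledEtAl2015, Thm 1.2 proof in §2, primal LP] -/
theorem resilient_of_feasible {d : ℕ} {g : (Fin n → Bool) → ℝ} (h : lpMatrix n d *ᵥ g ≤ lpRhs n) :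
    HasPureHighDegree d g ∧ ∀ x, |g x| ≤ 1 := by
  refine ⟨fun S hS => ?_, fun x => ?_⟩
  · have h1 := h (Sum.inr S, false)
    have h2 := h (Sum.inr S, true)
    rw [lpMatrix_mulVec_inr, if_pos hS] at h1 h2
    simp only [lpRhs, sgn_false, sgn_true, one_mul, neg_one_mul, neg_nonpos] at h1 h2
    exact le_antisymm h1 h2
  · have h1 := h (Sum.inl x, false)
    have h2 := h (Sum.inl x, true)
    rw [lpMatrix_mulVec_inl] at h1 h2
    simp only [lpRhs, sgn_false, sgn_true, one_mul, neg_one_mul] at h1 h2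
    exact abs_le.2 ⟨by linarith, h1⟩

/-- **Reading a dual solution** (§2: "variables `p_S` for every `S` of size at most `d`",
`q = f − Σ p_S χ_S`): for `y ≥ 0` on the rows, `yA` is `x ↦ (y(x,+) − y(x,−)) + Σ_{|S|≤d} (y(S,+) − y(S,−)) χ_S(x)`.
[cite: DachmanSoledEtAl2015, Thm 1.2 proof in §2, dual LP] -/
theorem vecMul_lpMatrix (d : ℕ) (y : ((Fin n → Bool) ⊕ Finset (Fin n)) × Bool → ℝ)
    (x : Fin n → Bool) :
    (y ᵥ* lpMatrix n d) x = (y (Sum.inl x, false) - y (Sum.inl x, true)) +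
      ∑ S ∈ univ.filter (fun S : Finset (Fin n) => S.card ≤ d),
        (y (Sum.inr S, false) - y (Sum.inr S, true)) * walsh S x := by
  simp only [vecMul, dotProduct]
  rw [Fintype.sum_prod_type, Fintype.sum_sum_type]
  congr 1
  · have key : ∀ x' : Fin n → Bool,
        ∑ b : Bool, y (Sum.inl x', b) * lpMatrix n d (Sum.inl x', b) x =
          if x = x' then y (Sum.inl x', false) - y (Sum.inl x', true) else 0 := fun x' => by
      rw [Fintype.sum_bool]
      simp only [lpMatrix, sgn_true, sgn_false]
      split_ifs <;> ring
    simp_rw [key]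
    rw [sum_ite_eq univ x, if_pos (mem_univ _)]
  · rw [sum_filter]
    refine sum_congr rfl fun S _ => ?_
    rw [Fintype.sum_bool]
    simp only [lpMatrix]
    split_ifs with h
    · simp only [sgn_true, sgn_false]
      ring
    · simp

/-- The dual objective: `yb = Σ_x (y(x,+) + y(x,−))`. [cite: DachmanSoledEtAl2015, Thm 1.2 proof in §2, dual LP] -/
theorem dotProduct_lpRhs (y : ((Fin n → Bool) ⊕ Finset (Fin n)) × Bool → ℝ) :
    y ⬝ᵥ lpRhs n = ∑ x : Fin n → Bool, (y (Sum.inl x, false) + y (Sum.inl x, true)) := by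
  simp only [dotProduct]
  rw [Fintype.sum_prod_type, Fintype.sum_sum_type]
  simp only [lpRhs, mul_one, mul_zero, sum_const_zero, add_zero]
  refine sum_congr rfl fun x _ => ?_
  rw [Fintype.sum_bool, add_comm]

/-- **Strong duality** (§2, "the claim of the theorem follows from LP duality"), for every real
`f`: there are a `d`-resilient `g` with `|g| ≤ 1` and a `p` of degree `≤ d` with
`E[fg] = E|f − p| = Δ_{𝒫_d}(f)` — the primal maximum equals the dual minimum, both attained.  Proof:
the Duality theorem of linear programming (`LPDuality.duality`; primal feasible by `g = 0`, dual
feasible by `f = f⁺ − f⁻`) gives `g` and `y ≥ 0` with `yA = f`, `Σ f g = yb`; reading `y` as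
`q = f − p = y(·,+) − y(·,−)` gives `Σ|f − p| ≤ Σ (y(·,+) + y(·,−)) = yb`, and weak duality closes
the chain. [cite: DachmanSoledEtAl2015, Thm 1.2 proof in §2] -/
theorem exists_optimal_pair (d : ℕ) (f : (Fin n → Bool) → ℝ) :
    ∃ g p : (Fin n → Bool) → ℝ, HasPureHighDegree d g ∧ (∀ x, |g x| ≤ 1) ∧ HasDegreeLE d p ∧
      cubeExpect (fun x => f x * g x) = l1Dist f p ∧ l1ApproxError d f = l1Dist f p := by
  set F : Finset (Finset (Fin n)) := univ.filter (fun S : Finset (Fin n) => S.card ≤ d) with hF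
  -- primal feasibility: `g = 0`
  have hP : ∃ g : (Fin n → Bool) → ℝ, lpMatrix n d *ᵥ g ≤ lpRhs n :=
    ⟨0, fun r => by
      rw [mulVec_zero]
      obtain ⟨x | S, b⟩ := r <;> simp [lpRhs]⟩
  -- dual feasibility: `f = f⁺ − f⁻`
  have hD : ∃ y : ((Fin n → Bool) ⊕ Finset (Fin n)) × Bool → ℝ, 0 ≤ y ∧ y ᵥ* lpMatrix n d = f := by
    let y0 : ((Fin n → Bool) ⊕ Finset (Fin n)) × Bool → ℝ := fun r =>
      match r with
      | (Sum.inl x, false) => max (f x) 0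
      | (Sum.inl x, true) => max (-f x) 0
      | (Sum.inr _, _) => 0
    have e1 : ∀ x, y0 (Sum.inl x, false) = max (f x) 0 := fun x => rfl
    have e2 : ∀ x, y0 (Sum.inl x, true) = max (-f x) 0 := fun x => rfl
    have e3 : ∀ S b, y0 (Sum.inr S, b) = 0 := fun S b => by cases b <;> rfl
    refine ⟨y0, fun r => ?_, funext fun x => ?_⟩
    · obtain ⟨x | S, b⟩ := r
      · cases b
        · rw [Pi.zero_apply, e1]; exact le_max_right _ _
        · rw [Pi.zero_apply, e2]; exact le_max_right _ _
      · rw [Pi.zero_apply, e3 S b]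
    · rw [vecMul_lpMatrix, e1, e2]
      simp_rw [e3, sub_self, zero_mul, sum_const_zero, add_zero]
      exact max_zero_sub_max_neg_zero_eq_self (f x)
  obtain ⟨g, y, hgA, hy0, hyA, hval⟩ :=
    Literature.Analysis.Convex.LPDuality.duality (lpMatrix n d) (lpRhs n) f hP hD
  obtain ⟨hres, hbd⟩ := resilient_of_feasible hgA
  -- read the dual solution as `p`, with `f − p = y(·,+) − y(·,−)`
  set p : (Fin n → Bool) → ℝ := fun x =>
    ∑ S ∈ F, (y (Sum.inr S, false) - y (Sum.inr S, true)) * walsh S x with hp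
  have hpdeg : HasDegreeLE d p := by
    rw [hasDegreeLE_iff_cubeFourierCoeff_eq_zero]
    intro S hS
    rw [hp, cubeFourierCoeff_sum_walsh, if_neg]
    simp [hF, not_le.2 hS]
  have hq : ∀ x, f x - p x = y (Sum.inl x, false) - y (Sum.inl x, true) := fun x => by
    have h := congrFun hyA x
    rw [vecMul_lpMatrix] at h
    rw [← h, hp]
    ring
  have hsum : ∑ x, |f x - p x| ≤ ∑ x, f x * g x := by
    have hv : f ⬝ᵥ g = ∑ x, f x * g x := rfl
    rw [← hv, hval, dotProduct_lpRhs]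
    refine sum_le_sum fun x _ => ?_
    rw [hq x, abs_sub_le_iff]
    have h1 : 0 ≤ y (Sum.inl x, false) := hy0 _
    have h2 : 0 ≤ y (Sum.inl x, true) := hy0 _
    constructor <;> linarith
  have h1 : l1Dist f p ≤ cubeExpect (fun x => f x * g x) :=
    div_le_div_of_nonneg_right hsum (by positivity)
  have h2 : cubeExpect (fun x => f x * g x) ≤ l1ApproxError d f :=
    cubeExpect_mul_le_l1ApproxError hres hbd
  have h3 : l1ApproxError d f ≤ l1Dist f p := l1ApproxError_le f hpdeg
  exact ⟨g, p, hres, hbd, hpdeg, le_antisymm (h2.trans h3) h1, le_antisymm h3 (h1.trans h2)⟩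

/-- **The duality, value form** (§2): `Δ_{𝒫_d}(f) = max{E[fg] : g d-resilient, |g| ≤ 1}` — the
maximum is attained and no resilient bounded `g` does better. [cite: DachmanSoledEtAl2015, Thm 1.2 proof in §2] -/
theorem l1ApproxError_eq_max (d : ℕ) (f : (Fin n → Bool) → ℝ) :
    (∃ g : (Fin n → Bool) → ℝ, HasPureHighDegree d g ∧ (∀ x, |g x| ≤ 1) ∧
        cubeExpect (fun x => f x * g x) = l1ApproxError d f) ∧
      ∀ g : (Fin n → Bool) → ℝ, HasPureHighDegree d g → (∀ x, |g x| ≤ 1) →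
        cubeExpect (fun x => f x * g x) ≤ l1ApproxError d f := by
  obtain ⟨g, p, hg, hgb, _, hfg, hΔ⟩ := exists_optimal_pair d f
  exact ⟨⟨g, hg, hgb, by rw [hfg, hΔ]⟩, fun g' hg' hgb' => cubeExpect_mul_le_l1ApproxError hg' hgb'⟩

/-! ### Theorem 1.2 (Boolean `f`) -/

/-- For `f(x) = ±1` and `|g(x)| ≤ 1`: `|f(x) − g(x)| = 1 − f(x)g(x)` (§2: "it is easy to see that
`‖f − g‖₁ = 1 − E[fg]`"). [cite: DachmanSoledEtAl2015, Thm 1.2 proof in §2] -/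
theorem abs_sub_eq_one_sub_mul {a b : ℝ} (ha : a = 1 ∨ a = -1) (hb : |b| ≤ 1) :
    |a - b| = 1 - a * b := by
  obtain ⟨hb1, hb2⟩ := abs_le.1 hb
  rcases ha with rfl | rfl
  · rw [abs_of_nonneg (by linarith)]; ring
  · rw [abs_of_nonpos (by linarith)]; ring

/-- Hence `‖f − g‖₁ = 1 − E[fg]` for `±1`-valued `f` and `|g| ≤ 1`. [cite: DachmanSoledEtAl2015, Thm 1.2 proof in §2] -/
theorem l1Dist_eq_one_sub {f g : (Fin n → Bool) → ℝ} (hf : ∀ x, f x = 1 ∨ f x = -1)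
    (hgb : ∀ x, |g x| ≤ 1) : l1Dist f g = 1 - cubeExpect (fun x => f x * g x) := by
  unfold l1Dist cubeExpect
  have h2 : (2 : ℝ) ^ n ≠ 0 := pow_ne_zero _ two_ne_zero
  rw [eq_sub_iff_add_eq, ← add_div, ← sum_add_distrib, div_eq_one_iff_eq h2]
  have key : ∀ x, |f x - g x| + f x * g x = 1 := fun x => by
    rw [abs_sub_eq_one_sub_mul (hf x) (hgb x)]; ring
  simp only [key, sum_const, card_univ, Fintype.card_fun, Fintype.card_bool, Fintype.card_fin,
    nsmul_eq_mul, mul_one, Nat.cast_pow, Nat.cast_ofNat]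

/-- **Dachman-Soled–Feldman–Tan–Wan–Wimmer 2015, Theorem 1.2.** For a `±1`-valued `f` on the cube,
`d` and `α`: `f` is `α`-approximately `d`-resilient if and only if `Δ_{𝒫_d}(f) ≥ 1 − α`
(print: `0 ≤ d ≤ n`, `α ≥ 0`; no restriction is needed). [cite: DachmanSoledEtAl2015, Theorem 1.2 (§1.1; proof in §2)] -/
theorem DachmanSoledEtAl2015_thm12 {f : (Fin n → Bool) → ℝ} (hf : ∀ x, f x = 1 ∨ f x = -1)
    (d : ℕ) (α : ℝ) : IsApproxResilient α d f ↔ 1 - α ≤ l1ApproxError d f := by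
  constructor
  · rintro ⟨g, hg, hgb, hdist⟩
    have h := cubeExpect_mul_le_l1ApproxError (f := f) hg hgb
    rw [l1Dist_eq_one_sub hf hgb] at hdist
    linarith
  · intro h
    obtain ⟨⟨g, hg, hgb, hfg⟩, _⟩ := l1ApproxError_eq_max d f
    refine ⟨g, hg, hgb, ?_⟩
    rw [l1Dist_eq_one_sub hf hgb, hfg]
    linarith

/-- **Theorem 1.2, restated form** (§2: "let `α` denote the `ℓ₁` distance of `f` to the
closest `d`-resilient bounded function. Then `Δ_{𝒫_d}(f) = 1 − α`"): for `±1`-valued `f` there is a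
closest `d`-resilient bounded `g`, at distance exactly `1 − Δ_{𝒫_d}(f)`.
[cite: DachmanSoledEtAl2015, Theorem 1.2 restated (§2)] -/
theorem DachmanSoledEtAl2015_thm12_restated {f : (Fin n → Bool) → ℝ} (hf : ∀ x, f x = 1 ∨ f x = -1)
    (d : ℕ) :
    (∃ g : (Fin n → Bool) → ℝ, HasPureHighDegree d g ∧ (∀ x, |g x| ≤ 1) ∧
        l1Dist f g = 1 - l1ApproxError d f) ∧
      ∀ g : (Fin n → Bool) → ℝ, HasPureHighDegree d g → (∀ x, |g x| ≤ 1) →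
        1 - l1ApproxError d f ≤ l1Dist f g := by
  obtain ⟨⟨g, hg, hgb, hfg⟩, hmax⟩ := l1ApproxError_eq_max d f
  refine ⟨⟨g, hg, hgb, by rw [l1Dist_eq_one_sub hf hgb, hfg]⟩, fun g' hg' hgb' => ?_⟩
  rw [l1Dist_eq_one_sub hf hgb']
  linarith [hmax g' hg' hgb']

end Literature.Computability.Complexity.ApproximateResilience
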